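import Literature.Analysis.FluidPDE.SuitableWeakRescaling
import Literature.Analysis.FluidPDE.SuitableWeakExhaustion
import Literature.Analysis.FluidPDE.DistributionalToWeak
import Literature.Analysis.FluidPDE.SelfSimilar
import HarnessLib

/-!
# Discretely self-similar suitable weak solutions: extension from the unit cylinder

Analysis/FluidPDE support file (proofs only, no new definitions) for the forward discretely
self-similar (DSS) existence theory of Bradshaw–Tsai (Analysis & PDE 12 (2019), Thm 1.2, fact
`Literature.Analysis.FluidPDE.bradshawTsai2019_dss_existence`). It proves the **extension
principle of loc. cit. §4.2–§4.3**: *a `λ`-DSS pair `(u, p)` which is a suitable weak solution of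
Navier–Stokes on the cylinder `Q₀ = (0, T) × B₁` near the space–time origin, with the local energy
classes of loc. cit. Prop. 3.1 on `Q₀` and attaining its (`λ`-DSS) datum `v₀` in `L²(K)` for compact
`K ⊆ B₁`, is a suitable weak solution on all of `(0, ∞) × E`, a weak solution with datum `v₀` on
`[0, T')` for every `T'`, attains the datum on every compact set, and has the energy classes
`L^∞(0,T'; L²(K))`, `L²(0,T'; H¹(K))`, `L^{3/2}((0,T') × K)` for all compact `K` and `T' > 0`* —
in print: "if a solution is DSS in a neighborhood of the origin, then it can be extended to a DSS
solution on `ℝ³ × (0,∞)`" (§4.2) and "For a general compact subset `K` of `ℝ³`, we have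
`K' = λ^m K ⊂ B₁` for some `m ∈ ℤ`, and `∫_K |v(x,t) − v₀(x)|² dx = λ^{-m} ∫_{K'} |v(x', λ^{2m}t)
− v₀(x')|² dx'` … A similar re-scaling argument also implies `v ∈ L^∞(0,T';L²(K)) ∩ L²(0,T';H¹(K))`
and `π ∈ L^{3/2}(0,T';L^{3/2}(K))` for any `T' > 0` and compact subset `K`" (§4.3).

The proof is bookkeeping over the tree's covariance and localisation results: by discrete
self-similarity `(u, p)` equals its own Navier–Stokes rescaling by `λ^{-m}`, which is a suitable
weak solution on the rescaled cylinder `Q_m = (0, λ^{2m}T) × B_{λ^m}`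
(`IsSuitableWeakSolutionOn.stRescale`, CKN 1982 §2); the `Q_m` exhaust the slab, so the notion
glues (`IsSuitableWeakSolutionOn.of_exhaustion`, `exists_hasWeakSpatialGradientOn_of_exhaustion`);
the classes and the datum are transported by the change of variables `x = λ^m y`, `t = λ^{2m} s`
(`setLIntegral_enorm_rpow_stRescale`, `setLIntegral_frobeniusNormSq_stRescale`,
`ae_restrict_Ioo_comp_time_affine`, `setLIntegral_preimage_comp_space_affine`); the weak
formulation with datum is the tree's `IsDistributionalNSSolutionOn.isWeakNSSolutionOn_datum`.
Everything is stated over a finite-dimensional inner product space `E` (the source has `E = ℝ³`);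
the main theorem is `BradshawTsai2019.extension`, whose conclusion for `E = ℝ³` is literally the
conclusion of Theorem 1.2 as rendered in `bradshawTsai2019_dss_existence`.

## References

* Z. Bradshaw, T.-P. Tsai, *Discretely self-similar solutions to the Navier–Stokes equations with
  data in `L²_loc` satisfying the local energy inequality*, Analysis & PDE 12 (2019) 1943–1962 =
  arXiv:1801.08060, §4.2 (DSS solutions in a neighborhood of the origin; extendability) and §4.3
  (proof of Thm 1.2: the re-scaling arguments) [BradshawTsai2019].
* L. Caffarelli, R. Kohn, L. Nirenberg, Comm. Pure Appl. Math. 35 (1982), §2 (scaling and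
  locality of suitable weak solutions) [CaffarelliKohnNirenberg1982].
-/

noncomputable section

open MeasureTheory TopologicalSpace Set Function Filter Topology Module Metric
open scoped InnerProductSpace RealInnerProductSpace ENNReal NNReal

namespace Literature.Analysis.FluidPDE

namespace BradshawTsai2019

/-! ### Iterating discrete self-similarity -/

section Algebra

variable {E : Type*} [NormedAddCommGroup E] [NormedSpace ℝ E]
variable {F : Type*} [NormedAddCommGroup F] [NormedSpace ℝ F]

/-- A `λ`-DSS field is `λ^m`-DSS for every `m ∈ ℕ` (Bradshaw–Tsai 2019, §3:
`v(x,t) = λ^k v(λ^k x, λ^{2k} t)` "for any `k ∈ ℤ`"). [cite: BradshawTsai2019, §3 (3.6)] -/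
theorem isDiscretelySelfSimilar_pow {c : ℝ} {u : ℝ → E → F} (h : IsDiscretelySelfSimilar c u)
    (m : ℕ) : IsDiscretelySelfSimilar (c ^ m) u := by
  induction m with
  | zero => rw [pow_zero]; exact nsRescale_one u
  | succ m ih => rw [pow_succ]; exact ih.mul h

/-- A `λ`-DSS field is `λ⁻¹`-DSS (`λ ≠ 0`). [cite: BradshawTsai2019, §3 (3.6)] -/
theorem isDiscretelySelfSimilar_inv {c : ℝ} (hc : c ≠ 0) {u : ℝ → E → F}
    (h : IsDiscretelySelfSimilar c u) : IsDiscretelySelfSimilar c⁻¹ u := by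
  unfold IsDiscretelySelfSimilar at h ⊢
  conv_lhs => rw [← h]
  exact nsRescale_inv_nsRescale hc u

/-- Group law of the pressure rescaling:
`nsRescalePressure (c d) p = nsRescalePressure d (nsRescalePressure c p)`. [folklore] -/
theorem nsRescalePressure_mul (c d : ℝ) (p : ℝ → E → ℝ) :
    nsRescalePressure (c * d) p = nsRescalePressure d (nsRescalePressure c p) := by
  funext t x
  simp only [nsRescalePressure_apply, mul_smul]
  rw [show (c * d) ^ 2 * t = c ^ 2 * (d ^ 2 * t) by ring]
  ring

/-- A `λ`-DSS pressure is `λ^m`-DSS for every `m ∈ ℕ`. [cite: BradshawTsai2019, §3 (3.6)] -/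
theorem nsRescalePressure_pow_eq {c : ℝ} {p : ℝ → E → ℝ} (h : nsRescalePressure c p = p)
    (m : ℕ) : nsRescalePressure (c ^ m) p = p := by
  induction m with
  | zero => rw [pow_zero]; exact nsRescalePressure_one p
  | succ m ih => rw [pow_succ, nsRescalePressure_mul, ih, h]

/-- A `λ`-DSS pressure is `λ⁻¹`-DSS (`λ ≠ 0`). [cite: BradshawTsai2019, §3 (3.6)] -/
theorem nsRescalePressure_inv_eq {c : ℝ} (hc : c ≠ 0) {p : ℝ → E → ℝ}
    (h : nsRescalePressure c p = p) : nsRescalePressure c⁻¹ p = p := by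
  conv_lhs => rw [← h]
  rw [← nsRescalePressure_mul, mul_inv_cancel₀ hc, nsRescalePressure_one]

/-- A `λ`-DSS datum is `λ^m`-DSS for every `m ∈ ℕ`. [cite: BradshawTsai2019, §3 (3.6)] -/
theorem nsRescaleData_pow_eq {c : ℝ} {v₀ : E → F} (h : nsRescaleData c v₀ = v₀) (m : ℕ) :
    nsRescaleData (c ^ m) v₀ = v₀ := by
  induction m with
  | zero => rw [pow_zero]; exact nsRescaleData_one v₀
  | succ m ih => rw [pow_succ, nsRescaleData_mul, ih, h]

/-- Pointwise form of `λ`-DSS at the scaled point: `u(t, λy) = λ⁻¹ u(λ⁻²t, y)` (`λ ≠ 0`). [folklore] -/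
theorem apply_smul_of_isDiscretelySelfSimilar {c : ℝ} (hc : c ≠ 0) {u : ℝ → E → F}
    (h : IsDiscretelySelfSimilar c u) (t : ℝ) (y : E) :
    u t (c • y) = c⁻¹ • u ((c ^ 2)⁻¹ * t) y := by
  have key : c • u (c ^ 2 * ((c ^ 2)⁻¹ * t)) (c • y) = u ((c ^ 2)⁻¹ * t) y :=
    congrFun (congrFun h ((c ^ 2)⁻¹ * t)) y
  rw [mul_inv_cancel_left₀ (pow_ne_zero 2 hc)] at key
  rw [← key, smul_smul, inv_mul_cancel₀ hc, one_smul]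

/-- Pointwise form of a `λ`-DSS datum at the scaled point: `v₀(λy) = λ⁻¹ v₀(y)` (`λ ≠ 0`). [folklore] -/
theorem apply_smul_of_nsRescaleData_eq {c : ℝ} (hc : c ≠ 0) {v₀ : E → F}
    (h : nsRescaleData c v₀ = v₀) (y : E) : v₀ (c • y) = c⁻¹ • v₀ y := by
  have key : c • v₀ (c • y) = v₀ y := congrFun h y
  rw [← key, smul_smul, inv_mul_cancel₀ hc, one_smul]

end Algebra

section AlgebraPull

variable {E : Type*} [NormedAddCommGroup E] [InnerProductSpace ℝ E]
variable {F : Type*} [NormedAddCommGroup F] [NormedSpace ℝ F]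

/-- The rescaled field of the parabolic scaling by `a` is the field itself when the field is
`a`-DSS: `a • u(a² s, a y) = u(s, y)`, in the `stPull` notation of `SpaceTimeRescaling`. [folklore] -/
theorem smul_stPull_eq_self {a : ℝ} {u : ℝ → E → F} (h : IsDiscretelySelfSimilar a u) :
    a • stPull (a * a) a 0 0 u = u := by
  funext t x
  rw [smul_stPull_apply, zero_add, zero_add, ← sq]
  exact congrFun (congrFun h t) x

/-- The rescaled pressure `a² p(a² s, a y)` is `p` when `p` is `a`-DSS. [folklore] -/
theorem sq_smul_stPull_eq_self {a : ℝ} {p : ℝ → E → ℝ} (h : nsRescalePressure a p = p) :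
    a ^ 2 • stPull (a * a) a 0 0 p = p := by
  funext t x
  have e : (a ^ 2 • stPull (a * a) a 0 0 p) t x = a ^ 2 * p (0 + a * a * t) (0 + a • x) := rfl
  rw [e, zero_add, zero_add, ← sq]
  exact congrFun (congrFun h t) x

end AlgebraPull

/-! ### The rescaled cylinders `Q_m = (0, λ^{2m} T) × B_{λ^m}` -/

section Cylinders

variable {E : Type*} [NormedAddCommGroup E] [InnerProductSpace ℝ E]

/-- The preimage of the cylinder `(0, T) × B₁` under the parabolic scaling by `a = γ⁻¹`
(`γ > 0`) is the cylinder `(0, γ²T) × B_γ`. [folklore] -/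
theorem stAffine_inv_preimage_unitCylinder {γ : ℝ} (hγ : 0 < γ) (T : ℝ) :
    stAffine (γ⁻¹ * γ⁻¹) γ⁻¹ 0 (0 : E) ⁻¹' (Ioo 0 T ×ˢ ball (0 : E) 1) =
      Ioo 0 (γ ^ 2 * T) ×ˢ ball (0 : E) γ := by
  have ha : 0 < γ⁻¹ := inv_pos.2 hγ
  rw [stAffine_preimage_cylinder (mul_pos ha ha) ha 0 (0 : E) 0 0 T 1]
  congr 1
  · rw [sub_zero, sub_zero, zero_div]
    congr 1
    field_simp
  · rw [sub_zero, smul_zero, one_div, inv_inv]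

variable [FiniteDimensional ℝ E] [MeasurableSpace E] [BorelSpace E]

/-- **Suitability on the rescaled cylinders.** If the `λ`-DSS pair `(u, p)` is a suitable weak
solution on an open set with carrier `(0, T) × B₁`, then it is a suitable weak solution on every
open set with carrier `(0, λ^{2m}T) × B_{λ^m}`, `m ∈ ℕ`: `(u, p)` coincides with its own
Navier–Stokes rescaling by `λ^{-m}`, which is suitable there (`IsSuitableWeakSolutionOn.stRescale`,
CKN 1982, §2). [cite: BradshawTsai2019, §4.2] -/
theorem isSuitableWeakSolutionOn_cylinder_pow {c : ℝ} (hc : 1 < c) {u : ℝ → E → E}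
    {p : ℝ → E → ℝ} (hu : IsDiscretelySelfSimilar c u) (hp : nsRescalePressure c p = p)
    {T : ℝ} {Q₀ : Opens (ℝ × E)} (hQ₀ : (Q₀ : Set (ℝ × E)) = Ioo 0 T ×ˢ ball (0 : E) 1)
    (h : IsSuitableWeakSolutionOn Q₀ 1 0 u p) (m : ℕ) {Q : Opens (ℝ × E)}
    (hQ : (Q : Set (ℝ × E)) = Ioo 0 ((c ^ m) ^ 2 * T) ×ˢ ball (0 : E) (c ^ m)) :
    IsSuitableWeakSolutionOn Q 1 0 u p := by
  have hc0 : 0 < c := zero_lt_one.trans hc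
  set γ : ℝ := c ^ m with hγ
  have hγ0 : 0 < γ := pow_pos hc0 m
  have ha : 0 < γ⁻¹ := inv_pos.2 hγ0
  have hua : IsDiscretelySelfSimilar γ⁻¹ u :=
    isDiscretelySelfSimilar_inv hγ0.ne' (isDiscretelySelfSimilar_pow hu m)
  have hpa : nsRescalePressure γ⁻¹ p = p :=
    nsRescalePressure_inv_eq hγ0.ne' (nsRescalePressure_pow_eq hp m)
  have h1 := h.stRescale (α := γ⁻¹) (β := γ⁻¹ * γ⁻¹) (γ := γ⁻¹) ha ha rfl 0 (0 : E)
  rw [smul_stPull_eq_self hua, sq_smul_stPull_eq_self hpa, mul_one, div_self ha.ne'] at h1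
  have hf : ((γ⁻¹ ^ 2 * γ⁻¹) • stPull (γ⁻¹ * γ⁻¹) γ⁻¹ 0 (0 : E) (0 : ℝ → E → E)) = 0 := by
    funext t x; simp
  rw [hf] at h1
  have hQeq : stPreimage (γ⁻¹ * γ⁻¹) γ⁻¹ 0 (0 : E) Q₀ = Q := by
    ext z
    rw [coe_stPreimage, hQ₀, hQ, stAffine_inv_preimage_unitCylinder hγ0]
  rwa [hQeq] at h1

omit [InnerProductSpace ℝ E] [FiniteDimensional ℝ E] [MeasurableSpace E] [BorelSpace E] in
/-- Every bounded-in-space, bounded-in-time subset of the open upper half space–time lies in one of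
the cylinders `(0, λ^{2m}T) × B_{λ^m}` (`λ > 1`, `T > 0`). [folklore] -/
theorem exists_subset_cylinder_pow {c : ℝ} (hc : 1 < c) {T : ℝ} (hT : 0 < T) {S : Set (ℝ × E)}
    {T' R : ℝ} (hS : ∀ z ∈ S, 0 < z.1 ∧ z.1 < T' ∧ ‖z.2‖ < R) :
    ∃ m : ℕ, S ⊆ Ioo 0 ((c ^ m) ^ 2 * T) ×ˢ ball (0 : E) (c ^ m) := by
  obtain ⟨m, hm⟩ := ((tendsto_pow_atTop_atTop_of_one_lt hc).eventually_ge_atTop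
    (max (max R (T' / T)) 1)).exists
  refine ⟨m, fun z hz => ?_⟩
  obtain ⟨h0, hT', hR⟩ := hS z hz
  have hm1 : 1 ≤ c ^ m := le_trans (le_max_right _ _) hm
  have hmR : R ≤ c ^ m := le_trans ((le_max_left _ _).trans (le_max_left _ _)) hm
  have hmT : T' / T ≤ c ^ m := le_trans ((le_max_right _ _).trans (le_max_left _ _)) hm
  refine ⟨⟨h0, ?_⟩, ?_⟩
  · have h1 : T' ≤ c ^ m * T := by rwa [div_le_iff₀ hT] at hmT
    calc z.1 < T' := hT'
      _ ≤ c ^ m * T := h1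
      _ ≤ (c ^ m) ^ 2 * T := by
          rw [sq]; exact mul_le_mul_of_nonneg_right (le_mul_of_one_le_left (by positivity) hm1) hT.le
  · rw [mem_ball_zero_iff]
    exact hR.trans_le hmR

omit [InnerProductSpace ℝ E] [FiniteDimensional ℝ E] [MeasurableSpace E] [BorelSpace E] in
/-- A compact subset of the open slab `(0, ∞) × E` is bounded away from `t = ∞` and in space, with
positive times. [folklore] -/
theorem exists_bounds_of_isCompact_subset_slab {K : Set (ℝ × E)}
    (hK : K ⊆ ((slab E (Ioi 0) isOpen_Ioi : Opens (ℝ × E)) : Set (ℝ × E))) (hKc : IsCompact K) :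
    ∃ T' R : ℝ, ∀ z ∈ K, 0 < z.1 ∧ z.1 < T' ∧ ‖z.2‖ < R := by
  obtain ⟨R, -, hR⟩ := hKc.isBounded.subset_ball_lt 0 (0 : ℝ × E)
  refine ⟨R, R, fun z hz => ⟨?_, ?_, ?_⟩⟩
  · have := hK hz
    rw [SetLike.mem_coe, mem_slab] at this
    exact this
  · have h1 : ‖z‖ < R := by simpa using hR hz
    exact (le_abs_self _).trans_lt ((norm_fst_le z).trans_lt h1)
  · have h1 : ‖z‖ < R := by simpa using hR hz
    exact (norm_snd_le z).trans_lt h1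

/-- **Suitability on the whole slab** (Bradshaw–Tsai 2019, §4.2: "if a solution is DSS in a
neighborhood of the origin, then it can be extended to a DSS solution on `ℝ³ × (0,∞)`"): a `λ`-DSS
pair which is a suitable weak solution on `(0, T) × B₁` is a suitable weak solution on
`(0, ∞) × E` (the cylinders `(0, λ^{2m}T) × B_{λ^m}` exhaust the slab;
`IsSuitableWeakSolutionOn.of_exhaustion`). [cite: BradshawTsai2019, §4.2] -/
theorem isSuitableWeakSolutionOn_slab {c : ℝ} (hc : 1 < c) {u : ℝ → E → E} {p : ℝ → E → ℝ}
    (hu : IsDiscretelySelfSimilar c u) (hp : nsRescalePressure c p = p) {T : ℝ} (hT : 0 < T)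
    {Q₀ : Opens (ℝ × E)} (hQ₀ : (Q₀ : Set (ℝ × E)) = Ioo 0 T ×ˢ ball (0 : E) 1)
    (h : IsSuitableWeakSolutionOn Q₀ 1 0 u p) :
    IsSuitableWeakSolutionOn (slab E (Ioi 0) isOpen_Ioi) 1 0 u p := by
  have hc0 : 0 < c := zero_lt_one.trans hc
  set Qn : ℕ → Opens (ℝ × E) := fun m =>
    ⟨Ioo 0 ((c ^ m) ^ 2 * T) ×ˢ ball (0 : E) (c ^ m), isOpen_Ioo.prod isOpen_ball⟩ with hQn
  have hQn_coe : ∀ m, ((Qn m : Opens (ℝ × E)) : Set (ℝ × E)) =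
      Ioo 0 ((c ^ m) ^ 2 * T) ×ˢ ball (0 : E) (c ^ m) := fun m => rfl
  refine IsSuitableWeakSolutionOn.of_exhaustion (Qn := Qn) (fun m => ?_) ?_ ?_ fun m =>
    isSuitableWeakSolutionOn_cylinder_pow hc hu hp hQ₀ h m (hQn_coe m)
  · intro z hz
    exact mem_slab.2 hz.1.1
  · refine monotone_nat_of_le_succ fun m z hz => ?_
    obtain ⟨⟨h0, h1⟩, h2⟩ := hz
    have hcm : c ^ m ≤ c ^ (m + 1) := pow_le_pow_right₀ hc.le m.le_succ
    refine ⟨⟨h0, h1.trans_le ?_⟩, ball_subset_ball hcm h2⟩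
    exact mul_le_mul_of_nonneg_right (pow_le_pow_left₀ (pow_pos hc0 m).le hcm 2) hT.le
  · intro K hK hKc
    obtain ⟨T', R, hb⟩ := exists_bounds_of_isCompact_subset_slab hK hKc
    exact exists_subset_cylinder_pow hc hT hb

end Cylinders

/-! ### Transport of the local classes and of the datum along the scaling -/

section Transport

variable {E : Type*} [NormedAddCommGroup E] [InnerProductSpace ℝ E] [FiniteDimensional ℝ E]
  [MeasurableSpace E] [BorelSpace E]

/-- Change of variables `x = γ y` (`γ > 0`) in a lower integral over a set:
`∫⁻_S F(x) dx = γⁿ ∫⁻_{γ⁻¹S} F(γ y) dy`. [folklore] -/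
theorem setLIntegral_eq_mul_setLIntegral_preimage_smul {γ : ℝ} (hγ : 0 < γ) (F : E → ℝ≥0∞)
    (S : Set E) :
    ∫⁻ x in S, F x = ENNReal.ofReal (γ ^ finrank ℝ E) *
      ∫⁻ y in (fun y : E => γ • y) ⁻¹' S, F (γ • y) := by
  have h1 := setLIntegral_preimage_comp_space_affine hγ (0 : E) F S
  simp only [zero_add] at h1
  rw [h1, ← mul_assoc, ← ENNReal.ofReal_mul (by positivity),
    mul_inv_cancel₀ (by positivity), ENNReal.ofReal_one, one_mul]

/-- Scaling law of the `L²`-mass of a DSS field against its DSS datum on scaled sets: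
`∫_{γK'} |u(t) − v₀|² = γ^{n−2} ∫_{K'} |u(γ⁻²t) − v₀|²`, `γ = λ^m` (Bradshaw–Tsai 2019, §4.3:
`∫_K |v(x,t) − v₀(x)|² dx = λ^{-m} ∫_{K'} |v(x', λ^{2m}t) − v₀(x')|² dx'`). [cite: BradshawTsai2019, §4.3] -/
theorem setLIntegral_enorm_sub_sq_eq_of_dss {γ : ℝ} (hγ : 0 < γ) {u : ℝ → E → E} {v₀ : E → E}
    (hu : IsDiscretelySelfSimilar γ u) (hv₀ : nsRescaleData γ v₀ = v₀) (K : Set E) (t : ℝ) :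
    ∫⁻ x in K, ‖u t x - v₀ x‖ₑ ^ 2 =
      ENNReal.ofReal (γ ^ finrank ℝ E) * ENNReal.ofReal γ⁻¹ ^ 2 *
        ∫⁻ y in (fun y : E => γ • y) ⁻¹' K, ‖u ((γ ^ 2)⁻¹ * t) y - v₀ y‖ₑ ^ 2 := by
  rw [setLIntegral_eq_mul_setLIntegral_preimage_smul hγ _ K, mul_assoc]
  congr 1
  have key : ∀ y : E, ‖u t (γ • y) - v₀ (γ • y)‖ₑ ^ 2 =
      ENNReal.ofReal γ⁻¹ ^ 2 * ‖u ((γ ^ 2)⁻¹ * t) y - v₀ y‖ₑ ^ 2 := by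
    intro y
    rw [apply_smul_of_isDiscretelySelfSimilar hγ.ne' hu, apply_smul_of_nsRescaleData_eq hγ.ne' hv₀,
      ← smul_sub, enorm_smul, mul_pow, Real.enorm_eq_ofReal (inv_nonneg.2 hγ.le)]
  simp_rw [key]
  rw [lintegral_const_mul' _ _ (by simp)]

/-- Scaling law of the sliced `L²`-mass of a DSS field on balls:
`∫_{B_{γr}} |u(t)|² = γ^{n−2} ∫_{B_r} |u(γ⁻²t)|²`. [cite: BradshawTsai2019, §3 (3.6)] -/
theorem setLIntegral_ball_enorm_sq_eq_of_dss {γ : ℝ} (hγ : 0 < γ) {u : ℝ → E → E}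
    (hu : IsDiscretelySelfSimilar γ u) (r t : ℝ) :
    ∫⁻ x in ball (0 : E) (γ * r), ‖u t x‖ₑ ^ 2 =
      ENNReal.ofReal (γ ^ finrank ℝ E) * ENNReal.ofReal γ⁻¹ ^ 2 *
        ∫⁻ y in ball (0 : E) r, ‖u ((γ ^ 2)⁻¹ * t) y‖ₑ ^ 2 := by
  have hpre : (fun y : E => γ • y) ⁻¹' ball (0 : E) (γ * r) = ball 0 r := by
    ext y
    simp only [mem_preimage, mem_ball_zero_iff, norm_smul, Real.norm_eq_abs, abs_of_pos hγ]
    exact ⟨fun h => lt_of_mul_lt_mul_left h hγ.le, fun h => mul_lt_mul_of_pos_left h hγ⟩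
  have h0 : nsRescaleData γ (0 : E → E) = 0 := by funext x; simp
  have := setLIntegral_enorm_sub_sq_eq_of_dss hγ hu h0 (ball (0 : E) (γ * r)) t
  simp only [Pi.zero_apply, sub_zero] at this
  rw [this, hpre]

/-- **Transport of the datum** (Bradshaw–Tsai 2019, §4.3): if a `λ`-DSS field `u` attains the
`λ`-DSS datum `v₀` in `L²(K')` as `t → 0⁺` for every compact `K' ⊆ B₁`, then it attains it in
`L²(K)` for every compact `K` ("For a general compact subset `K` of `ℝ³`, we have `K' = λ^m K ⊂ B₁`
for some `m ∈ ℤ` … It follows that `lim_{t→0⁺} ‖v(t) − v₀‖_{L²(K)} = 0`"). [cite: BradshawTsai2019, §4.3] -/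
theorem tendsto_datum_of_dss {c : ℝ} (hc : 1 < c) {u : ℝ → E → E} {v₀ : E → E}
    (hu : IsDiscretelySelfSimilar c u) (hv₀ : nsRescaleData c v₀ = v₀)
    (h : ∀ K : Set E, IsCompact K → K ⊆ ball 0 1 →
      Tendsto (fun t => ∫⁻ x in K, ‖u t x - v₀ x‖ₑ ^ 2) (𝓝[>] 0) (𝓝 0))
    {K : Set E} (hK : IsCompact K) :
    Tendsto (fun t => ∫⁻ x in K, ‖u t x - v₀ x‖ₑ ^ 2) (𝓝[>] 0) (𝓝 0) := by
  have hc0 : 0 < c := zero_lt_one.trans hc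
  obtain ⟨R, -, hR⟩ := hK.isBounded.subset_ball_lt 0 (0 : E)
  obtain ⟨m, hm⟩ := ((tendsto_pow_atTop_atTop_of_one_lt hc).eventually_ge_atTop R).exists
  set γ : ℝ := c ^ m with hγ
  have hγ0 : 0 < γ := pow_pos hc0 m
  have hγu : IsDiscretelySelfSimilar γ u := isDiscretelySelfSimilar_pow hu m
  have hγv : nsRescaleData γ v₀ = v₀ := nsRescaleData_pow_eq hv₀ m
  -- the rescaled compact set `K' = γ⁻¹ K ⊆ B₁`
  set K' : Set E := (fun y : E => γ • y) ⁻¹' K with hK'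
  have hK'c : IsCompact K' :=
    (Homeomorph.smul (Units.mk0 γ hγ0.ne')).isCompact_preimage.2 hK
  have hK'sub : K' ⊆ ball 0 1 := by
    intro y hy
    have h1 : ‖γ • y‖ < γ := by
      have := hR hy
      rw [mem_ball_zero_iff] at this
      exact this.trans_le hm
    rw [norm_smul, Real.norm_eq_abs, abs_of_pos hγ0] at h1
    rw [mem_ball_zero_iff]
    by_contra hcon
    exact absurd h1 (not_lt.2 (le_mul_of_one_le_right hγ0.le (not_lt.1 hcon)))
  have hlim := h K' hK'c hK'sub
  -- `t ↦ γ⁻² t` maps `0⁺` to `0⁺`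
  have hmap : Tendsto (fun t : ℝ => (γ ^ 2)⁻¹ * t) (𝓝[>] 0) (𝓝[>] 0) := by
    refine tendsto_nhdsWithin_iff.2 ⟨?_, ?_⟩
    · have h1 : Tendsto (fun t : ℝ => (γ ^ 2)⁻¹ * t) (𝓝 0) (𝓝 ((γ ^ 2)⁻¹ * 0)) :=
        tendsto_id.const_mul _
      rw [mul_zero] at h1
      exact h1.mono_left nhdsWithin_le_nhds
    · filter_upwards [self_mem_nhdsWithin] with t ht using mem_Ioi.2 (mul_pos (by positivity) ht)
  have hcomp := hlim.comp hmap
  have hconst : ENNReal.ofReal (γ ^ finrank ℝ E) * ENNReal.ofReal γ⁻¹ ^ 2 ≠ ⊤ :=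
    ENNReal.mul_ne_top ENNReal.ofReal_ne_top (by simp)
  have hfin := ENNReal.Tendsto.const_mul hcomp (Or.inr hconst)
  rw [mul_zero] at hfin
  refine hfin.congr' (Eventually.of_forall fun t => ?_)
  simp only [comp_apply]
  rw [setLIntegral_enorm_sub_sq_eq_of_dss hγ0 hγu hγv K t]

/-- Transport of the square-integrability in space–time to the rescaled cylinders:
`∫∫_{(0,λ^{2m}T)×B_{λ^m}} |u|² = λ^{m(n+2)}·λ^{-2m} ∫∫_{(0,T)×B₁} |u|²` is finite with the latter. [cite: BradshawTsai2019, §4.3] -/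
theorem setLIntegral_cylinder_enorm_sq_lt_top_of_dss {c : ℝ} (hc : 1 < c) {u : ℝ → E → E}
    (hu : IsDiscretelySelfSimilar c u) {T : ℝ}
    (h : ∫⁻ z in Ioo 0 T ×ˢ ball (0 : E) 1, ‖u z.1 z.2‖ₑ ^ 2 < ⊤) (m : ℕ) :
    ∫⁻ z in Ioo 0 ((c ^ m) ^ 2 * T) ×ˢ ball (0 : E) (c ^ m), ‖u z.1 z.2‖ₑ ^ 2 < ⊤ := by
  have hc0 : 0 < c := zero_lt_one.trans hc
  have hγ0 : 0 < c ^ m := pow_pos hc0 m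
  have ha : 0 < (c ^ m)⁻¹ := inv_pos.2 hγ0
  have hrepr : (c ^ m)⁻¹ • stPull ((c ^ m)⁻¹ * (c ^ m)⁻¹) (c ^ m)⁻¹ 0 (0 : E) u = u :=
    smul_stPull_eq_self (isDiscretelySelfSimilar_inv hγ0.ne' (isDiscretelySelfSimilar_pow hu m))
  have key := setLIntegral_enorm_pow_stRescale (mul_pos ha ha) ha 0 (0 : E) (c ^ m)⁻¹ u
    (Ioo 0 T ×ˢ ball (0 : E) 1) 2
  rw [hrepr, stAffine_inv_preimage_unitCylinder hγ0] at key
  rw [key]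
  exact ENNReal.mul_lt_top (ENNReal.mul_lt_top (ENNReal.pow_lt_top enorm_lt_top)
    ENNReal.ofReal_lt_top) h

/-- Transport of the `L^r` pressure class to the rescaled cylinders:
`∫∫_{(0,λ^{2m}T)×B_{λ^m}} |p|^r` is finite with `∫∫_{(0,T)×B₁} |p|^r` for a `λ`-DSS pressure
(Bradshaw–Tsai 2019, §4.3: "`π ∈ L^{3/2}(0,T';L^{3/2}(K))` for any `T' > 0` and compact subset
`K`" by re-scaling). [cite: BradshawTsai2019, §4.3] -/
theorem setLIntegral_cylinder_enorm_rpow_lt_top_of_dss {c : ℝ} (hc : 1 < c) {p : ℝ → E → ℝ}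
    (hp : nsRescalePressure c p = p) {T r : ℝ} (hr : 0 ≤ r)
    (h : ∫⁻ z in Ioo 0 T ×ˢ ball (0 : E) 1, ‖p z.1 z.2‖ₑ ^ r < ⊤) (m : ℕ) :
    ∫⁻ z in Ioo 0 ((c ^ m) ^ 2 * T) ×ˢ ball (0 : E) (c ^ m), ‖p z.1 z.2‖ₑ ^ r < ⊤ := by
  have hc0 : 0 < c := zero_lt_one.trans hc
  have hγ0 : 0 < c ^ m := pow_pos hc0 m
  have ha : 0 < (c ^ m)⁻¹ := inv_pos.2 hγ0
  have hrepr : (c ^ m)⁻¹ ^ 2 • stPull ((c ^ m)⁻¹ * (c ^ m)⁻¹) (c ^ m)⁻¹ 0 (0 : E) p = p :=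
    sq_smul_stPull_eq_self (nsRescalePressure_inv_eq hγ0.ne' (nsRescalePressure_pow_eq hp m))
  have key := setLIntegral_enorm_rpow_stRescale (mul_pos ha ha) ha 0 (0 : E) ((c ^ m)⁻¹ ^ 2) p
    (Ioo 0 T ×ˢ ball (0 : E) 1) hr
  rw [hrepr, stAffine_inv_preimage_unitCylinder hγ0] at key
  rw [key]
  exact ENNReal.mul_lt_top (ENNReal.mul_lt_top (ENNReal.rpow_lt_top_of_nonneg hr enorm_ne_top)
    ENNReal.ofReal_lt_top) h

/-- The sliced energy bound on the unit cylinder makes the field square integrable there: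
`∫∫_{(0,T)×B₁} |u|² ≤ T · esssup_{0<t<T} ∫_{B₁} |u(t)|²` (Tonelli). [folklore] -/
theorem setLIntegral_unitCylinder_enorm_sq_lt_top {u : ℝ → E → E} {T : ℝ} {C₀ : ℝ≥0}
    (hen : ∀ᵐ t ∂(volume.restrict (Ioo 0 T)), ∫⁻ x in ball (0 : E) 1, ‖u t x‖ₑ ^ 2 ≤ C₀) :
    ∫⁻ z in Ioo 0 T ×ˢ ball (0 : E) 1, ‖u z.1 z.2‖ₑ ^ 2 < ⊤ := by
  have h1 : ((volume : Measure (ℝ × E)).restrict (Ioo 0 T ×ˢ ball (0 : E) 1)) =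
      ((volume : Measure ℝ).restrict (Ioo 0 T)).prod
        ((volume : Measure E).restrict (ball (0 : E) 1)) := by
    rw [Measure.volume_eq_prod, Measure.prod_restrict]
  rw [h1]
  refine (lintegral_prod_le _).trans_lt ?_
  calc ∫⁻ t in Ioo 0 T, ∫⁻ x in ball (0 : E) 1, ‖u (t, x).1 (t, x).2‖ₑ ^ 2
      ≤ ∫⁻ _ in Ioo 0 T, (C₀ : ℝ≥0∞) := lintegral_mono_ae hen
    _ = C₀ * volume (Ioo 0 T) := by rw [lintegral_const, Measure.restrict_apply_univ]
    _ < ⊤ := ENNReal.mul_lt_top ENNReal.coe_lt_top (by simp [Real.volume_Ioo])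

/-- **Transport of the sliced energy bound** (Bradshaw–Tsai 2019, §4.3, "a similar re-scaling
argument also implies `v ∈ L^∞(0,T';L²(K))`"): an `esssup_{0<t<T} ∫_{B₁} |u(t)|²` bound for a
`λ`-DSS field gives, for every compact `K` and `T' > 0`, an `esssup_{0<t<T'} ∫_K |u(t)|²` bound. [cite: BradshawTsai2019, §4.3] -/
theorem exists_ae_energy_bound_of_dss {c : ℝ} (hc : 1 < c) {u : ℝ → E → E}
    (hu : IsDiscretelySelfSimilar c u) {T : ℝ} (hT : 0 < T) {C₀ : ℝ≥0}
    (hen : ∀ᵐ t ∂(volume.restrict (Ioo 0 T)), ∫⁻ x in ball (0 : E) 1, ‖u t x‖ₑ ^ 2 ≤ C₀)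
    {K : Set E} (hK : IsCompact K) {T' : ℝ} (hT' : 0 < T') :
    ∃ C : ℝ≥0, ∀ᵐ t ∂(volume.restrict (Ioo 0 T')), ∫⁻ x in K, ‖u t x‖ₑ ^ 2 ≤ C := by
  have hc0 : 0 < c := zero_lt_one.trans hc
  rcases K.eq_empty_or_nonempty with rfl | ⟨x₁, hx₁⟩
  · exact ⟨0, Eventually.of_forall fun t => by simp⟩
  obtain ⟨R, -, hR⟩ := hK.isBounded.subset_ball_lt 0 (0 : E)
  have hS : ∀ z ∈ Ioo 0 T' ×ˢ K, 0 < z.1 ∧ z.1 < T' ∧ ‖z.2‖ < R := fun z hz =>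
    ⟨hz.1.1, hz.1.2, mem_ball_zero_iff.1 (hR hz.2)⟩
  obtain ⟨m, hm⟩ := exists_subset_cylinder_pow (E := E) hc hT hS
  set γ : ℝ := c ^ m with hγ
  have hγ0 : 0 < γ := pow_pos hc0 m
  have hγu : IsDiscretelySelfSimilar γ u := isDiscretelySelfSimilar_pow hu m
  have hsubT : Ioo 0 T' ⊆ Ioo 0 (γ ^ 2 * T) := fun t ht => (hm (mk_mem_prod ht hx₁)).1
  have hKball : K ⊆ ball (0 : E) (γ * 1) := fun x hx => by
    rw [mul_one]; exact (hm (mk_mem_prod ⟨half_pos hT', half_lt_self hT'⟩ hx)).2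
  -- transport the a.e.-in-time bound along `s ↦ γ⁻² s`
  have hen' : ∀ᵐ t ∂(volume.restrict (Ioo (0 + (γ ^ 2)⁻¹ * 0) (0 + (γ ^ 2)⁻¹ * (γ ^ 2 * T)))),
      ∫⁻ x in ball (0 : E) 1, ‖u t x‖ₑ ^ 2 ≤ C₀ := by
    rwa [mul_zero, add_zero, zero_add, inv_mul_cancel_left₀ (pow_ne_zero 2 hγ0.ne')]
  have htr := ae_restrict_Ioo_comp_time_affine (inv_pos.2 (pow_pos hγ0 2)) 0 0 (γ ^ 2 * T) hen'
  set C : ℝ≥0∞ := ENNReal.ofReal (γ ^ finrank ℝ E) * ENNReal.ofReal γ⁻¹ ^ 2 * C₀ with hC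
  have hCtop : C ≠ ⊤ :=
    ENNReal.mul_ne_top (ENNReal.mul_ne_top ENNReal.ofReal_ne_top (by simp)) ENNReal.coe_ne_top
  refine ⟨C.toNNReal, ?_⟩
  rw [ENNReal.coe_toNNReal hCtop]
  filter_upwards [ae_restrict_of_ae_restrict_of_subset hsubT htr] with t ht
  rw [zero_add] at ht
  calc ∫⁻ x in K, ‖u t x‖ₑ ^ 2 ≤ ∫⁻ x in ball (0 : E) (γ * 1), ‖u t x‖ₑ ^ 2 :=
        lintegral_mono_set hKball
    _ = ENNReal.ofReal (γ ^ finrank ℝ E) * ENNReal.ofReal γ⁻¹ ^ 2 *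
          ∫⁻ y in ball (0 : E) 1, ‖u ((γ ^ 2)⁻¹ * t) y‖ₑ ^ 2 :=
        setLIntegral_ball_enorm_sq_eq_of_dss hγ0 hγu 1 t
    _ ≤ C := mul_le_mul_right ht _

/-- **Transport of the pressure class**: `∫∫_{(0,T')×K} |p|^{3/2} < ∞` for every compact `K` and
`T' > 0`, given it on the unit cylinder, for a `λ`-DSS pressure. [cite: BradshawTsai2019, §4.3] -/
theorem setLIntegral_enorm_rpow_lt_top_of_dss {c : ℝ} (hc : 1 < c) {p : ℝ → E → ℝ}
    (hp : nsRescalePressure c p = p) {T : ℝ} (hT : 0 < T) {r : ℝ} (hr : 0 ≤ r)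
    (h : ∫⁻ z in Ioo 0 T ×ˢ ball (0 : E) 1, ‖p z.1 z.2‖ₑ ^ r < ⊤)
    {K : Set E} (hK : IsCompact K) (T' : ℝ) :
    ∫⁻ z in Ioo 0 T' ×ˢ K, ‖p z.1 z.2‖ₑ ^ r < ⊤ := by
  obtain ⟨R, -, hR⟩ := hK.isBounded.subset_ball_lt 0 (0 : E)
  have hS : ∀ z ∈ Ioo 0 T' ×ˢ K, 0 < z.1 ∧ z.1 < T' ∧ ‖z.2‖ < R := fun z hz =>
    ⟨hz.1.1, hz.1.2, mem_ball_zero_iff.1 (hR hz.2)⟩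
  obtain ⟨m, hm⟩ := exists_subset_cylinder_pow (E := E) hc hT hS
  exact lt_of_le_of_lt (lintegral_mono_set hm)
    (setLIntegral_cylinder_enorm_rpow_lt_top_of_dss hc hp hr h m)

/-- **Transport of the local square-integrability of the velocity** up to `t = 0`:
`∫∫_{(0,T')×K} |u|² < ∞` for every compact `K`, given the sliced energy bound on the unit
cylinder, for a `λ`-DSS field. [cite: BradshawTsai2019, §4.3] -/
theorem setLIntegral_enorm_sq_lt_top_of_dss {c : ℝ} (hc : 1 < c) {u : ℝ → E → E}
    (hu : IsDiscretelySelfSimilar c u) {T : ℝ} (hT : 0 < T) {C₀ : ℝ≥0}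
    (hen : ∀ᵐ t ∂(volume.restrict (Ioo 0 T)), ∫⁻ x in ball (0 : E) 1, ‖u t x‖ₑ ^ 2 ≤ C₀)
    {K : Set E} (hK : IsCompact K) (T' : ℝ) :
    ∫⁻ z in Ioo 0 T' ×ˢ K, ‖uncurry u z‖ₑ ^ 2 < ⊤ := by
  obtain ⟨R, -, hR⟩ := hK.isBounded.subset_ball_lt 0 (0 : E)
  have hS : ∀ z ∈ Ioo 0 T' ×ˢ K, 0 < z.1 ∧ z.1 < T' ∧ ‖z.2‖ < R := fun z hz =>
    ⟨hz.1.1, hz.1.2, mem_ball_zero_iff.1 (hR hz.2)⟩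
  obtain ⟨m, hm⟩ := exists_subset_cylinder_pow (E := E) hc hT hS
  exact lt_of_le_of_lt (lintegral_mono_set hm) (setLIntegral_cylinder_enorm_sq_lt_top_of_dss hc hu
    (setLIntegral_unitCylinder_enorm_sq_lt_top hen) m)

/-- **Transport of the dissipation**: a weak spatial gradient `G₀` of the `λ`-DSS field `u` on the
unit cylinder with `∫∫_{(0,T)×B₁} |G₀|² < ∞` yields a weak spatial gradient `G` of `u` on the whole
slab `(0, ∞) × E` (glued from the rescaled gradients `λ^{-2m} G₀(λ^{-2m}·, λ^{-m}·)` on the cylinders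
`(0, λ^{2m}T) × B_{λ^m}`, `exists_hasWeakSpatialGradientOn_of_exhaustion`) with
`∫∫_{(0,T')×K} |G|² < ∞` for all compact `K`, `T' > 0` (Bradshaw–Tsai 2019, §4.3:
"`v ∈ L²(0,T';H¹(K))`" by re-scaling). [cite: BradshawTsai2019, §4.3] -/
theorem exists_hasWeakSpatialGradientOn_slab_of_dss {c : ℝ} (hc : 1 < c) {u : ℝ → E → E}
    (hu : IsDiscretelySelfSimilar c u) {T : ℝ} (hT : 0 < T) {Q₀ : Opens (ℝ × E)}
    (hQ₀ : (Q₀ : Set (ℝ × E)) = Ioo 0 T ×ˢ ball (0 : E) 1) {G₀ : ℝ → E → E →L[ℝ] E}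
    (hG₀ : HasWeakSpatialGradientOn Q₀ u G₀)
    (hfin : ∫⁻ z in Ioo 0 T ×ˢ ball (0 : E) 1, ENNReal.ofReal (frobeniusNormSq (G₀ z.1 z.2)) < ⊤) :
    ∃ G : ℝ → E → E →L[ℝ] E, HasWeakSpatialGradientOn (slab E (Ioi 0) isOpen_Ioi) u G ∧
      ∀ K : Set E, IsCompact K → ∀ T' : ℝ, 0 < T' →
        ∫⁻ z in Ioo 0 T' ×ˢ K, ENNReal.ofReal (frobeniusNormSq (G z.1 z.2)) < ⊤ := by
  have hc0 : 0 < c := zero_lt_one.trans hc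
  set Qn : ℕ → Opens (ℝ × E) := fun m =>
    ⟨Ioo 0 ((c ^ m) ^ 2 * T) ×ˢ ball (0 : E) (c ^ m), isOpen_Ioo.prod isOpen_ball⟩ with hQn
  have hQn_coe : ∀ m, ((Qn m : Opens (ℝ × E)) : Set (ℝ × E)) =
      Ioo 0 ((c ^ m) ^ 2 * T) ×ˢ ball (0 : E) (c ^ m) := fun m => rfl
  have hmono : Monotone Qn := by
    refine monotone_nat_of_le_succ fun m z hz => ?_
    obtain ⟨⟨h0, h1⟩, h2⟩ := hz
    have hcm : c ^ m ≤ c ^ (m + 1) := pow_le_pow_right₀ hc.le m.le_succ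
    refine ⟨⟨h0, h1.trans_le ?_⟩, ball_subset_ball hcm h2⟩
    exact mul_le_mul_of_nonneg_right (pow_le_pow_left₀ (pow_pos hc0 m).le hcm 2) hT.le
  have hcov : ∀ K ⊆ ((slab E (Ioi 0) isOpen_Ioi : Opens (ℝ × E)) : Set (ℝ × E)), IsCompact K →
      ∃ m, K ⊆ (Qn m : Set (ℝ × E)) := by
    intro K hK hKc
    obtain ⟨T', R, hb⟩ := exists_bounds_of_isCompact_subset_slab hK hKc
    exact exists_subset_cylinder_pow hc hT hb
  set Gm : ℕ → ℝ → E → E →L[ℝ] E := fun m =>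
    ((c ^ m)⁻¹ * (c ^ m)⁻¹) • stPull ((c ^ m)⁻¹ * (c ^ m)⁻¹) (c ^ m)⁻¹ 0 (0 : E) G₀ with hGm
  have hGm' : ∀ m, HasWeakSpatialGradientOn (Qn m) u (Gm m) := by
    intro m
    have hγ0 : 0 < c ^ m := pow_pos hc0 m
    have ha : 0 < (c ^ m)⁻¹ := inv_pos.2 hγ0
    have h1 := hG₀.stRescale (c ^ m)⁻¹ (mul_pos ha ha) ha 0 (0 : E)
    rw [smul_stPull_eq_self
      (isDiscretelySelfSimilar_inv hγ0.ne' (isDiscretelySelfSimilar_pow hu m))] at h1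
    have hQeq : stPreimage ((c ^ m)⁻¹ * (c ^ m)⁻¹) (c ^ m)⁻¹ 0 (0 : E) Q₀ = Qn m := by
      ext z
      rw [coe_stPreimage, hQ₀, hQn_coe, stAffine_inv_preimage_unitCylinder hγ0]
    rwa [hQeq] at h1
  obtain ⟨G, hG, hGae⟩ :=
    exists_hasWeakSpatialGradientOn_of_exhaustion (Q := slab E (Ioi 0) isOpen_Ioi) hmono hcov hGm'
  refine ⟨G, hG, fun K hK T' hT' => ?_⟩
  obtain ⟨R, -, hR⟩ := hK.isBounded.subset_ball_lt 0 (0 : E)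
  have hS : ∀ z ∈ Ioo 0 T' ×ˢ K, 0 < z.1 ∧ z.1 < T' ∧ ‖z.2‖ < R := fun z hz =>
    ⟨hz.1.1, hz.1.2, mem_ball_zero_iff.1 (hR hz.2)⟩
  obtain ⟨m, hm⟩ := exists_subset_cylinder_pow (E := E) hc hT hS
  have hγ0 : 0 < c ^ m := pow_pos hc0 m
  have ha : 0 < (c ^ m)⁻¹ := inv_pos.2 hγ0
  calc ∫⁻ z in Ioo 0 T' ×ˢ K, ENNReal.ofReal (frobeniusNormSq (G z.1 z.2))
      = ∫⁻ z in Ioo 0 T' ×ˢ K, ENNReal.ofReal (frobeniusNormSq (Gm m z.1 z.2)) := by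
        refine setLIntegral_congr_of_ae_imp (measurableSet_Ioo.prod hK.isClosed.measurableSet)
          (hm.trans (hQn_coe m).symm.subset) ?_
        filter_upwards [hGae m] with z hz hzS
        rw [show G z.1 z.2 = Gm m z.1 z.2 from hz hzS]
    _ ≤ ∫⁻ z in Ioo 0 ((c ^ m) ^ 2 * T) ×ˢ ball (0 : E) (c ^ m),
          ENNReal.ofReal (frobeniusNormSq (Gm m z.1 z.2)) := lintegral_mono_set hm
    _ < ⊤ := by
        rw [← stAffine_inv_preimage_unitCylinder hγ0 T, hGm,
          setLIntegral_frobeniusNormSq_stRescale (mul_pos ha ha) ha 0 (0 : E) _ G₀]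
        exact ENNReal.mul_lt_top (ENNReal.mul_lt_top ENNReal.ofReal_lt_top ENNReal.ofReal_lt_top)
          hfin

end Transport

/-! ### The extension theorem -/

section Extension

variable {E : Type*} [NormedAddCommGroup E] [InnerProductSpace ℝ E] [FiniteDimensional ℝ E]
  [MeasurableSpace E] [BorelSpace E]

/-- **Weak solution with datum on every `[0, T')`**: a `λ`-DSS suitable weak solution on the slab
with the sliced energy bound on the unit cylinder and attaining the measurable `λ`-DSS datum `v₀`
in `L²(K')` for compact `K' ⊆ B₁` is a (pressure-free) weak solution with datum `v₀` on `[0, T')`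
for every `T'` (`IsDistributionalNSSolutionOn.isWeakNSSolutionOn_datum`: cut-off in time; the
classes up to `t = 0` and the datum on all compacts are transported by the scaling). [cite: BradshawTsai2019, §4.3] -/
theorem isWeakNSSolutionOn_of_dss {c : ℝ} (hc : 1 < c) {v₀ : E → E}
    (hm₀ : AEStronglyMeasurable v₀ volume) (hv₀ : nsRescaleData c v₀ = v₀) {u : ℝ → E → E}
    {p : ℝ → E → ℝ} (hu : IsDiscretelySelfSimilar c u)
    (hslab : IsSuitableWeakSolutionOn (slab E (Ioi 0) isOpen_Ioi) 1 0 u p) {T : ℝ} (hT : 0 < T)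
    {C₀ : ℝ≥0}
    (hen : ∀ᵐ t ∂(volume.restrict (Ioo 0 T)), ∫⁻ x in ball (0 : E) 1, ‖u t x‖ₑ ^ 2 ≤ C₀)
    (hdatum : ∀ K : Set E, IsCompact K → K ⊆ ball 0 1 →
      Tendsto (fun t => ∫⁻ x in K, ‖u t x - v₀ x‖ₑ ^ 2) (𝓝[>] 0) (𝓝 0))
    (T' : ℝ) : IsWeakNSSolutionOn T' 1 0 v₀ u := by
  refine IsDistributionalNSSolutionOn.isWeakNSSolutionOn_datum (p := p)
    (hslab.distributional.of_le (slab_mono Ioo_subset_Ioi_self))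
    (fun K hK => setLIntegral_enorm_sq_lt_top_of_dss hc hu hT hen hK T')
    (fun K _ => ?_) hm₀ (fun K hK => tendsto_datum_of_dss hc hu hv₀ hdatum hK)
  exact integrableOn_zero

/-- **The extension principle (Bradshaw–Tsai 2019, §4.2–§4.3).** Let `λ > 1`, let `v₀` be a
measurable `λ`-DSS datum, and let `(u, p)` be a `λ`-DSS pair (`λ u(λ²t, λx) = u(t,x)`,
`λ² p(λ²t, λx) = p(t,x)` identically) which on the unit cylinder `Q₀ = (0, T) × B₁` is a suitable
weak solution of Navier–Stokes (`ν = 1`, `f = 0`) with `esssup_{0<t<T} ∫_{B₁} |u(t)|² ≤ C₀`, a weak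
spatial gradient in `L²(Q₀)` and `p ∈ L^{3/2}(Q₀)`, and which attains `v₀` in `L²(K')` as `t → 0⁺`
for every compact `K' ⊆ B₁`. Then `u` is `λ`-DSS (trivially), a weak solution with datum `v₀` on
`[0, T')` for all `T' > 0`, `(u, p)` is a suitable weak solution on `(0, ∞) × E`, the datum is
attained in `L²(K)` for every compact `K`, and `u ∈ L^∞(0,T'; L²(K))`, `p ∈ L^{3/2}((0,T') × K)`,
`∇u ∈ L²((0,T') × K)` for all compact `K` and `T' > 0` — for `E = ℝ³` verbatim the conclusion of
Theorem 1.2 as rendered in `bradshawTsai2019_dss_existence`. In print: §4.2 ("if a solution is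
DSS in a neighborhood of the origin, then it can be extended to a DSS solution on `ℝ³ × (0,∞)`")
and the re-scaling arguments of §4.3. [cite: BradshawTsai2019, §4.2–§4.3 (proof of Thm 1.2)] -/
theorem extension {c : ℝ} (hc : 1 < c) {v₀ : E → E} (hm₀ : AEStronglyMeasurable v₀ volume)
    (hv₀ : nsRescaleData c v₀ = v₀) {u : ℝ → E → E} {p : ℝ → E → ℝ}
    (hu : IsDiscretelySelfSimilar c u) (hp : nsRescalePressure c p = p) {T : ℝ} (hT : 0 < T)
    {Q₀ : Opens (ℝ × E)} (hQ₀ : (Q₀ : Set (ℝ × E)) = Ioo 0 T ×ˢ ball (0 : E) 1)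
    (hsuit : IsSuitableWeakSolutionOn Q₀ 1 0 u p) {C₀ : ℝ≥0}
    (hen : ∀ᵐ t ∂(volume.restrict (Ioo 0 T)), ∫⁻ x in ball (0 : E) 1, ‖u t x‖ₑ ^ 2 ≤ C₀)
    (hgrad : ∃ G₀ : ℝ → E → E →L[ℝ] E, HasWeakSpatialGradientOn Q₀ u G₀ ∧
      ∫⁻ z in Ioo 0 T ×ˢ ball (0 : E) 1, ENNReal.ofReal (frobeniusNormSq (G₀ z.1 z.2)) < ⊤)
    (hpress : ∫⁻ z in Ioo 0 T ×ˢ ball (0 : E) 1, ‖p z.1 z.2‖ₑ ^ (3 / 2 : ℝ) < ⊤)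
    (hdatum : ∀ K : Set E, IsCompact K → K ⊆ ball 0 1 →
      Tendsto (fun t => ∫⁻ x in K, ‖u t x - v₀ x‖ₑ ^ 2) (𝓝[>] 0) (𝓝 0)) :
    IsDiscretelySelfSimilar c u ∧
    (∀ T' : ℝ, 0 < T' → IsWeakNSSolutionOn T' 1 0 v₀ u) ∧
    IsSuitableWeakSolutionOn (slab E (Ioi 0) isOpen_Ioi) 1 0 u p ∧
    (∀ K : Set E, IsCompact K →
      Tendsto (fun t => ∫⁻ x in K, ‖u t x - v₀ x‖ₑ ^ 2) (𝓝[>] 0) (𝓝 0)) ∧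
    (∀ K : Set E, IsCompact K → ∀ T' : ℝ, 0 < T' →
      (∃ C : ℝ≥0, ∀ᵐ t ∂(volume.restrict (Ioo 0 T')), ∫⁻ x in K, ‖u t x‖ₑ ^ 2 ≤ C) ∧
      ∫⁻ z in Ioo 0 T' ×ˢ K, ‖p z.1 z.2‖ₑ ^ (3 / 2 : ℝ) < (⊤ : ℝ≥0∞)) ∧
    (∃ G : ℝ → E → E →L[ℝ] E,
      HasWeakSpatialGradientOn (slab E (Ioi 0) isOpen_Ioi) u G ∧
      ∀ K : Set E, IsCompact K → ∀ T' : ℝ, 0 < T' →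
        ∫⁻ z in Ioo 0 T' ×ˢ K, ENNReal.ofReal (frobeniusNormSq (G z.1 z.2)) < (⊤ : ℝ≥0∞)) := by
  have hslab := isSuitableWeakSolutionOn_slab hc hu hp hT hQ₀ hsuit
  obtain ⟨G₀, hG₀, hG₀fin⟩ := hgrad
  exact ⟨hu, fun T' _ => isWeakNSSolutionOn_of_dss hc hm₀ hv₀ hu hslab hT hen hdatum T', hslab,
    fun K hK => tendsto_datum_of_dss hc hu hv₀ hdatum hK,
    fun K hK T' hT' => ⟨exists_ae_energy_bound_of_dss hc hu hT hen hK hT',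
      setLIntegral_enorm_rpow_lt_top_of_dss hc hp hT (by norm_num) hpress hK T'⟩,
    exists_hasWeakSpatialGradientOn_slab_of_dss hc hu hT hQ₀ hG₀ hG₀fin⟩

end Extension

end BradshawTsai2019

end Literature.Analysis.FluidPDE

end
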